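import Summits.ResolutionOfSingularities.ResolutionOfSingularities.Theorems.HomologicalConductorNoZenoCompositeDominator
import HarnessLib

/-!
# Crux `NoZenoR` / `NoZeno` (stmt-ResolutionOfSingularities-19943 / -16483) — (Z) SUPPLIED INSIDE THE THREAD

Route `ResolutionOfSingularities/HomologicalConductor`, W4.4 chain, line `thread-composite` r1.1/r1.2 §1d (author
res-L0-w44-strat-1 g12, `L/res-L0-w44-strat-1/line-thread-composite-r1.lean` 67f4e090c4899181; CHAIN v24 (ρ38h)(1) follow-up):
the TREE HOME, DEF-FREE, of `exists_composite_below_divisor` — from the verbatim binders of the thread layer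
(`Sig.NoDivisorialThread` / `Sig.NoDivisorialThreadBP`: kernel binder `hker`, primes `P`, a valuation ring `V` containing /
dominating the germs) produce a composite `W < V` that DOMINATES the `O`-tower (same tower), is NON-NOETHERIAN, and along
which `StrictDrop` holds — i.e. the inserted hypothesis (Z) `∀ W, TowerDominated O A W → DropsAlong O A W` of the line's
residual `Sig.NoDivisorialThreadBPZ` is non-vacuous below the thread's prime divisor.  Two forms: strat-1's (noetherian
`V` dominating the germs) and the maximal form (escape element instead of noetherianity; `W` maximal among dominators).
Proofs = `CompositeDominator.exists_dominator_le` / `exists_maxDominator_lt_of_thread` + `strictDrop_of_dominates`.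
OURS (cell res-hironaka): AI-produced and kernel-checked, weaker than expert review; nothing here is a statement of the
manuscript under review (Hironaka 2017); fact-free, counted 0.
-/

noncomputable section

-- single-problem summit: the doubled namespace component `ResolutionOfSingularities` is forced
set_option linter.dupNamespace false

namespace Summit.ResolutionOfSingularities.ResolutionOfSingularities.Theorems.NoZeno.CompositeDominator

open Summit.ResolutionOfSingularities.ResolutionOfSingularities.Theses.HomologicalConductor
open Summit.ResolutionOfSingularities.ResolutionOfSingularities.Theorems.NoZeno.Birth
open Summit.ResolutionOfSingularities.ResolutionOfSingularities.Theorems.NoZeno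
open Literature.AlgebraicGeometry.Resolution

variable {k K : Type} [Field k] [Field K] [Algebra k K]

/-! ## (Z) supplied inside the thread — r1.x §1d, def-free -/

open Summit.ResolutionOfSingularities.ResolutionOfSingularities.Theorems.NoZeno.SandwichCluster in
/-- **(Z) INSIDE THE THREAD** (res-L0-w44-strat-1, `thread-composite` r1.1 §1d `exists_composite_below_divisor`, here
def-free and proved from `exists_dominator_le` / `strictDrop_of_dominates`).  Over the verbatim thread binders: if every
dominator of the `O`-tower is non-noetherian (`hker`) and a NOETHERIAN valuation ring `V` (the thread's prime divisor)
dominates every germ `D_(n+1) = (T_(n+1))_(P_(n+1))`, then some `W ≤ V`, `W ≠ V`, dominates the `O`-tower (so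
`tower W A = tower O A`, `tower_eq_of_dominates`), is non-noetherian, and `StrictDrop` holds for the `O`-tower measured
by `W` (`= DropsAlong O A W` of the line). [this work; composition only] -/
theorem exists_composite_below_divisor (hD : StrictDrop) (p : ℕ) (hp : p.Prime) (k K : Type) [Field k]
    [CharP k p] [Field K] [Algebra k K] (O : ValuationSubring K) (A : Subalgebra k K)
    (hk : ∀ c : k, algebraMap k K c ∈ O) (hA : A.FG) (hfr : IsFractionRing ↥A K)
    (hAO : A.toSubring ≤ O.toSubring)
    (hker : ∀ O' : ValuationSubring K,
      (∀ m : ℕ, ∀ s ∈ tower O A m, s ∈ O' ∧ (s⁻¹ ∈ O' → s⁻¹ ∈ O)) → ¬ IsNoetherianRing ↥O')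
    (P : ∀ m : ℕ, Ideal ↥(tower O A m)) (hP : ∀ m, (P m).IsPrime) (V : ValuationSubring K)
    (hVN : IsNoetherianRing ↥V)
    (hdomV : ∀ n : ℕ, SubringDominates (Parasite.locPrime (tower O A (n + 1)) (P (n + 1)) (hP (n + 1)))
      V.toSubring) :
    ∃ W : ValuationSubring K, W ≤ V ∧ W ≠ V ∧
      (∀ m : ℕ, ∀ s ∈ tower O A m, s ∈ W ∧ (s⁻¹ ∈ W → s⁻¹ ∈ O)) ∧ ¬ IsNoetherianRing ↥W ∧
      ∀ m : ℕ, ¬ IsRegularLocalRing ↥(tower O A m) → ∃ m' : ℕ, m < m' ∧ ∃ y ∈ ca (tower O A m'), y ≠ 0 ∧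
        ∀ x ∈ ca (tower O A m), x ≠ 0 → y * x⁻¹ ∉ W := by
  have hV : ∀ m : ℕ, ∀ t ∈ tower O A m, t ∈ V := fun m t ht =>
    (hdomV m).1 (Parasite.mem_locPrime_of_mem _ _ _ (d2rc_mem_tower_of_le O A (Nat.le_succ m) ht))
  obtain ⟨W, hWV, hdom⟩ := exists_dominator_le O A V hk hAO hV
  have hWN : ¬ IsNoetherianRing ↥W := hker W hdom
  refine ⟨W, hWV, ?_, hdom, hWN, fun m hm => strictDrop_of_dominates hD p hp k K O A W hk hA hfr hAO hdom m hm⟩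
  rintro rfl
  exact hWN hVN

open Summit.ResolutionOfSingularities.ResolutionOfSingularities.Theorems.NoZeno.SandwichCluster in
/-- **(Z) INSIDE THE THREAD, maximal form.**  With the thread's compatibility and escape binders (`hcompat`, `s ∈ T_(mₑ)`
with `O.valuation s < 1`, `s ∉ P mₑ`) instead of noetherianity of `V`: some MAXIMAL dominator `W` of the `O`-tower has
`W < V`, is non-noetherian (`hker`), has the same tower, and `StrictDrop` holds for the `O`-tower measured by `W`; every
`U > W` (in particular `V`, and every valuation ring strictly between) inverts a stage element that `O` does not.
[this work; composition only] -/
theorem exists_maxComposite_below_divisor (hD : StrictDrop) (p : ℕ) (hp : p.Prime) (k K : Type) [Field k]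
    [CharP k p] [Field K] [Algebra k K] (O : ValuationSubring K) (A : Subalgebra k K)
    (hk : ∀ c : k, algebraMap k K c ∈ O) (hA : A.FG) (hfr : IsFractionRing ↥A K)
    (hAO : A.toSubring ≤ O.toSubring)
    (hker : ∀ O' : ValuationSubring K,
      (∀ m : ℕ, ∀ s ∈ tower O A m, s ∈ O' ∧ (s⁻¹ ∈ O' → s⁻¹ ∈ O)) → ¬ IsNoetherianRing ↥O')
    (P : ∀ m : ℕ, Ideal ↥(tower O A m)) (hP : ∀ m, (P m).IsPrime)
    (hcompat : ∀ (m : ℕ) (x : K) (hx : x ∈ tower O A m) (hx' : x ∈ tower O A (m + 1)),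
      (⟨x, hx'⟩ : ↥(tower O A (m + 1))) ∈ P (m + 1) ↔ (⟨x, hx⟩ : ↥(tower O A m)) ∈ P m)
    (mₑ : ℕ) (s : K) (hsT : s ∈ tower O A mₑ) (hvs : O.valuation s < 1)
    (hsP : (⟨s, hsT⟩ : ↥(tower O A mₑ)) ∉ P mₑ) (V : ValuationSubring K)
    (hV : ∀ n : ℕ, Parasite.locPrime (tower O A (n + 1)) (P (n + 1)) (hP (n + 1)) ≤ V.toSubring) :
    ∃ W : ValuationSubring K, W < V ∧
      (∀ m : ℕ, ∀ s ∈ tower O A m, s ∈ W ∧ (s⁻¹ ∈ W → s⁻¹ ∈ O)) ∧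
      (∀ U : ValuationSubring K, W < U → ∃ m : ℕ, ∃ s ∈ tower O A m, s⁻¹ ∈ U ∧ s⁻¹ ∉ O) ∧
      ¬ IsNoetherianRing ↥W ∧ (∀ m : ℕ, tower W A m = tower O A m) ∧
      ∀ m : ℕ, ¬ IsRegularLocalRing ↥(tower O A m) → ∃ m' : ℕ, m < m' ∧ ∃ y ∈ ca (tower O A m'), y ≠ 0 ∧
        ∀ x ∈ ca (tower O A m), x ≠ 0 → y * x⁻¹ ∉ W := by
  obtain ⟨W, hWV, hdom, hmax⟩ :=
    exists_maxDominator_lt_of_thread O A V hk hA hfr hAO P hP hcompat mₑ s hsT hvs hsP hV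
  exact ⟨W, hWV, hdom, hmax, hker W hdom, tower_eq_of_dominates O A W hk hA hfr hAO hdom,
    fun m hm => strictDrop_of_dominates hD p hp k K O A W hk hA hfr hAO hdom m hm⟩

end Summit.ResolutionOfSingularities.ResolutionOfSingularities.Theorems.NoZeno.CompositeDominator

end
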